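import Mathlib.LinearAlgebra.CrossProduct
import Summits.AnomalousDissipation.AnomalousDissipation.Theorems.MomentParityQuarticGateModeCalculus

/-!
# Solving for the packet amplitudes: two packets realise any transversal stress at momentum `q`

Helper file for stub S5 (`stub_balancedMenu`) of the line `farkas-split-menu` of crux
`MomentParity.CubicParityLoud` (stmt-AnomalousDissipation-11465). Given a momentum `q ≠ 0`, two
packet wavevectors `k₁, k₂` (`|kᵢ|² ≤ 2`, `det(k₁, q, k₂) ≠ 0`, file `…BalancedMenuLattice`) and a
TARGET `τ ∈ ℂ³` with `q · τ = 0`, the amplitudes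
`xᵢ = λ uᵢ`, `uᵢ = |kᵢ|² q - (q·kᵢ) kᵢ ⊥ kᵢ`, `λ = (1 + |q|²)⁻²`, and `yᵢ = βᵢ wᵢ`, `wᵢ = kᵢ × q ⊥ kᵢ, q`,
`βᵢ = αᵢ / (4πi λ Dᵢ)`, `Dᵢ = |wᵢ|²`, `α₁ = (τ · (w₂ × q))/Dt`, `α₂ = (τ · (q × w₁))/Dt`,
`Dt = w₁ · (w₂ × q) = -det(k₁,q,k₂)|q|²`, satisfy the STRESS EQUATION
`∑ᵢ (4πi x̄ᵢ·q) • yᵢ = α₁ w₁ + α₂ w₂ = τ` (reciprocal-basis expansion of `τ ⊥ q` along `w₁, w₂`)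
with the COST BOUNDS `‖xᵢ‖² ≤ 4 (1+|q|²)⁻³`, `‖yᵢ‖² ≤ ‖τ‖² (1+|q|²)⁴ / 16` (no `|q|`-loss thanks to
`|Dt| ≥ |q|²`). Pure finite-dimensional algebra (`crossProduct`, Lagrange's identity).
-/

namespace Summit.AnomalousDissipation.AnomalousDissipation.Theorems.MomentParityCubicParityLoud

open Finset Complex Matrix
open scoped ComplexConjugate
open Literature.Analysis.FunctionSpaces Literature.Analysis.FluidPDE

set_option linter.dupNamespace false

/-! ## Integer vector identities -/

section IntegerIdentities

variable (k q k₁ k₂ : Fin 3 → ℤ)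

/-- The projection `u = |k|² q - (q·k) k` of `q` is orthogonal to `k`. [folklore] -/
theorem proj_dotProduct_self : ((k ⬝ᵥ k) • q - (q ⬝ᵥ k) • k) ⬝ᵥ k = 0 := by
  simp only [sub_dotProduct, smul_dotProduct, smul_eq_mul, dotProduct_comm q k, mul_comm, sub_self]

/-- `u · q = |k × q|²` (Lagrange). [folklore] -/
theorem proj_dotProduct_eq : ((k ⬝ᵥ k) • q - (q ⬝ᵥ k) • k) ⬝ᵥ q = (k ⨯₃ q) ⬝ᵥ (k ⨯₃ q) := by
  rw [sub_dotProduct, smul_dotProduct, smul_dotProduct, smul_eq_mul, smul_eq_mul, cross_dot_cross,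
    dotProduct_comm q k]

/-- `|u|² = |k|² |k × q|²`. [folklore] -/
theorem proj_dotProduct_proj : ((k ⬝ᵥ k) • q - (q ⬝ᵥ k) • k) ⬝ᵥ ((k ⬝ᵥ k) • q - (q ⬝ᵥ k) • k) =
    (k ⬝ᵥ k) * ((k ⨯₃ q) ⬝ᵥ (k ⨯₃ q)) := by
  simp only [sub_dotProduct, dotProduct_sub, smul_dotProduct, dotProduct_smul, smul_eq_mul, cross_dot_cross,
    dotProduct_comm q k]
  ring

/-- The triple product of the two stress directions with `q`: `(k₁×q) · ((k₂×q) × q) = -det(k₁,q,k₂) |q|²`.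
[folklore] -/
theorem cross_dotProduct_cross_cross :
    (k₁ ⨯₃ q) ⬝ᵥ ((k₂ ⨯₃ q) ⨯₃ q) = -(k₁ ⬝ᵥ (q ⨯₃ k₂)) * (q ⬝ᵥ q) := by
  simp only [dotProduct, cross_apply, Fin.sum_univ_three, cons_val_zero, cons_val_one, cons_val_two, head_cons,
    tail_cons, Nat.succ_eq_add_one, Nat.reduceAdd]
  ring

/-- `(k₁×q) × (k₂×q) = -det(k₁,q,k₂) q`. [folklore] -/
theorem cross_cross_cross_eq_smul : (k₁ ⨯₃ q) ⨯₃ (k₂ ⨯₃ q) = (-(k₁ ⬝ᵥ (q ⨯₃ k₂))) • q := by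
  funext i
  fin_cases i <;> simp [cross_apply, dotProduct, Fin.sum_univ_three] <;> ring

/-- `|w × q|² = |w|²|q|²` for `w = k × q ⊥ q`. [folklore] -/
theorem cross_cross_dotProduct_self :
    ((k ⨯₃ q) ⨯₃ q) ⬝ᵥ ((k ⨯₃ q) ⨯₃ q) = ((k ⨯₃ q) ⬝ᵥ (k ⨯₃ q)) * (q ⬝ᵥ q) := by
  rw [cross_dot_cross, dotProduct_comm (k ⨯₃ q) q, dot_cross_self]
  ring

/-- `|q × w|² = |w|²|q|²` for `w = k × q ⊥ q`. [folklore] -/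
theorem self_cross_cross_dotProduct :
    (q ⨯₃ (k ⨯₃ q)) ⬝ᵥ (q ⨯₃ (k ⨯₃ q)) = ((k ⨯₃ q) ⬝ᵥ (k ⨯₃ q)) * (q ⬝ᵥ q) := by
  rw [cross_dot_cross, dotProduct_comm (k ⨯₃ q) q, dot_cross_self]
  ring

/-- A non-zero integer has square at least one (real form). [folklore] -/
theorem one_le_sq_cast_of_ne_zero {n : ℤ} (hn : n ≠ 0) : (1 : ℝ) ≤ (n : ℝ) ^ 2 := by
  have h : 1 ≤ |n| := Int.one_le_abs hn
  have h' : (1 : ℝ) ≤ |(n : ℝ)| := by rw [← Int.cast_abs]; exact_mod_cast h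
  nlinarith [abs_nonneg (n : ℝ), sq_abs (n : ℝ)]

/-- `|k|²` as an integer dot product. [folklore] -/
theorem cast_dotProduct_self_eq_freqNormSq : ((k ⬝ᵥ k : ℤ) : ℝ) = Torus.freqNormSq k := by
  simp [dotProduct, Torus.freqNormSq, sq]

end IntegerIdentities

/-! ## Complex side: frequency vectors, reciprocal basis -/

section ComplexSide

/-- The frequency vector of a cross product is the cross product of the frequency vectors. [folklore] -/
theorem ofLp_freqVec_cross (a b : Fin 3 → ℤ) :
    WithLp.ofLp (Torus.freqVec (a ⨯₃ b)) = (WithLp.ofLp (Torus.freqVec a)) ⨯₃ (WithLp.ofLp (Torus.freqVec b)) := by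
  funext j
  fin_cases j <;> simp [cross_apply, Torus.freqVec]

/-- Dot products of frequency vectors are the cast integer dot products. [folklore] -/
theorem ofLp_freqVec_dotProduct (a b : Fin 3 → ℤ) :
    (WithLp.ofLp (Torus.freqVec a)) ⬝ᵥ (WithLp.ofLp (Torus.freqVec b)) = ((a ⬝ᵥ b : ℤ) : ℂ) := by
  simp [dotProduct, Torus.freqVec]

/-- The frequency vector of `r • a`. [folklore] -/
theorem freqVec_smul (r : ℤ) (a : Fin 3 → ℤ) : Torus.freqVec (r • a) = (r : ℂ) • Torus.freqVec a := by
  ext j; simp [Torus.freqVec]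

/-- `‖freqVec a‖² = |a|²`. [folklore] -/
theorem norm_sq_freqVec (a : Fin 3 → ℤ) : ‖Torus.freqVec a‖ ^ 2 = Torus.freqNormSq a := by
  rw [EuclideanSpace.norm_sq_eq, Torus.freqNormSq]
  refine Finset.sum_congr rfl fun j _ => ?_
  rw [Torus.freqVec_apply, Complex.norm_intCast, ← Int.cast_abs, Int.cast_abs, sq_abs]

/-- The frequency vector is the complexification of the real lattice vector. [folklore] -/
theorem freqVec_eq_complexify (a : Fin 3 → ℤ) :
    Torus.freqVec a = EuclideanSpace.complexify (Torus.latticeVec a) := by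
  ext j; simp [Torus.freqVec, Torus.latticeVec_apply]

/-- **Cauchy–Schwarz for the bilinear pairing with a lattice vector**: `|∑ⱼ aⱼ τⱼ|² ≤ |a|² ‖τ‖²`.
[folklore] -/
theorem norm_sq_sum_mul_le (a : Fin 3 → ℤ) (τ : EuclideanSpace ℂ (Fin 3)) :
    ‖∑ j, (a j : ℂ) * τ j‖ ^ 2 ≤ Torus.freqNormSq a * ‖τ‖ ^ 2 := by
  rw [← Torus.inner_freqVec_left, ← norm_sq_freqVec, ← mul_pow]
  exact pow_le_pow_left₀ (norm_nonneg _) (norm_inner_le_norm _ _) 2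

/-- Reciprocal-basis expansion in `ℂ³`:
`(u·(v×w)) x = (x·(v×w)) u + (x·(w×u)) v + (x·(u×v)) w`. [folklore] -/
theorem triple_decomp_complex (u v w x : Fin 3 → ℂ) :
    (u ⬝ᵥ (v ⨯₃ w)) • x = (x ⬝ᵥ (v ⨯₃ w)) • u + (x ⬝ᵥ (w ⨯₃ u)) • v + (x ⬝ᵥ (u ⨯₃ v)) • w := by
  simp_rw [cross_apply, vec3_dotProduct]
  ext i
  fin_cases i <;>
  · simp only [Fin.isValue, Nat.succ_eq_add_one, Nat.reduceAdd, Fin.reduceFinMk, Matrix.cons_val,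
      Pi.add_apply, Pi.smul_apply, smul_eq_mul, Fin.zero_eta, Fin.mk_one, cons_val_zero, cons_val_one]
    ring

/-- **Expansion of a transversal target along the two stress directions**: with `w₁ = k₁ × q`,
`w₂ = k₂ × q`, `Dt = w₁ · (w₂ × q) ≠ 0` and `q · τ = 0`,
`τ = ((∑ⱼ (w₂ × q)ⱼ τⱼ)/Dt) • w₁ + ((∑ⱼ (q × w₁)ⱼ τⱼ)/Dt) • w₂`. [folklore] -/
theorem target_eq_sum_smul {q k₁ k₂ : Fin 3 → ℤ} (hdet : k₁ ⬝ᵥ (q ⨯₃ k₂) ≠ 0) (hq : q ≠ 0)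
    {τ : EuclideanSpace ℂ (Fin 3)} (hτ : ∑ j, (q j : ℂ) * τ j = 0) :
    τ = ((∑ j, ((((k₂ ⨯₃ q) ⨯₃ q) j : ℤ) : ℂ) * τ j) / (((k₁ ⨯₃ q) ⬝ᵥ ((k₂ ⨯₃ q) ⨯₃ q) : ℤ) : ℂ)) •
        Torus.freqVec (k₁ ⨯₃ q) +
      ((∑ j, (((q ⨯₃ (k₁ ⨯₃ q)) j : ℤ) : ℂ) * τ j) / (((k₁ ⨯₃ q) ⬝ᵥ ((k₂ ⨯₃ q) ⨯₃ q) : ℤ) : ℂ)) •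
        Torus.freqVec (k₂ ⨯₃ q) := by
  set U : Fin 3 → ℂ := WithLp.ofLp (Torus.freqVec (k₁ ⨯₃ q)) with hU
  set V : Fin 3 → ℂ := WithLp.ofLp (Torus.freqVec (k₂ ⨯₃ q)) with hV
  set W : Fin 3 → ℂ := WithLp.ofLp (Torus.freqVec q) with hW
  set X : Fin 3 → ℂ := WithLp.ofLp τ with hX
  have hDt : (((k₁ ⨯₃ q) ⬝ᵥ ((k₂ ⨯₃ q) ⨯₃ q) : ℤ) : ℂ) ≠ 0 := by
    rw [cross_dotProduct_cross_cross]
    have hqq : q ⬝ᵥ q ≠ 0 := by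
      intro h
      apply hq
      have : Torus.freqNormSq q = 0 := by rw [← cast_dotProduct_self_eq_freqNormSq, h, Int.cast_zero]
      exact (Torus.freqNormSq_eq_zero_iff q).1 this
    exact_mod_cast mul_ne_zero (neg_ne_zero.2 hdet) hqq
  have hdec := triple_decomp_complex U V W X
  have hVW : V ⨯₃ W = WithLp.ofLp (Torus.freqVec ((k₂ ⨯₃ q) ⨯₃ q)) := by rw [ofLp_freqVec_cross]
  have hWU : W ⨯₃ U = WithLp.ofLp (Torus.freqVec (q ⨯₃ (k₁ ⨯₃ q))) := by rw [ofLp_freqVec_cross]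
  have hUV : U ⨯₃ V = (-(k₁ ⬝ᵥ (q ⨯₃ k₂) : ℤ) : ℂ) • W := by
    rw [hU, hV, ← ofLp_freqVec_cross, cross_cross_cross_eq_smul, freqVec_smul, WithLp.ofLp_smul, Int.cast_neg]
  have hXW : X ⬝ᵥ W = 0 := by
    rw [dotProduct_comm]
    simpa [hW, hX, dotProduct, Torus.freqVec] using hτ
  have hUVW : U ⬝ᵥ (V ⨯₃ W) = (((k₁ ⨯₃ q) ⬝ᵥ ((k₂ ⨯₃ q) ⨯₃ q) : ℤ) : ℂ) := by
    rw [hVW, hU, ofLp_freqVec_dotProduct]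
  rw [hUV, dotProduct_smul, hXW, smul_eq_mul, mul_zero, zero_smul, add_zero, hUVW, hVW, hWU,
    dotProduct_comm X, dotProduct_comm X] at hdec
  have hb1 : WithLp.ofLp (Torus.freqVec ((k₂ ⨯₃ q) ⨯₃ q)) ⬝ᵥ X = ∑ j, ((((k₂ ⨯₃ q) ⨯₃ q) j : ℤ) : ℂ) * τ j := by
    simp [hX, dotProduct, Torus.freqVec]
  have hb2 : WithLp.ofLp (Torus.freqVec (q ⨯₃ (k₁ ⨯₃ q))) ⬝ᵥ X = ∑ j, (((q ⨯₃ (k₁ ⨯₃ q)) j : ℤ) : ℂ) * τ j := by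
    simp [hX, dotProduct, Torus.freqVec]
  rw [hb1, hb2] at hdec
  -- divide by `Dt` and pass to `EuclideanSpace`
  have hfun : X = ((∑ j, ((((k₂ ⨯₃ q) ⨯₃ q) j : ℤ) : ℂ) * τ j) / (((k₁ ⨯₃ q) ⬝ᵥ ((k₂ ⨯₃ q) ⨯₃ q) : ℤ) : ℂ)) • U +
      ((∑ j, (((q ⨯₃ (k₁ ⨯₃ q)) j : ℤ) : ℂ) * τ j) / (((k₁ ⨯₃ q) ⬝ᵥ ((k₂ ⨯₃ q) ⨯₃ q) : ℤ) : ℂ)) • V := by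
    have := congrArg (fun Z => ((((k₁ ⨯₃ q) ⬝ᵥ ((k₂ ⨯₃ q) ⨯₃ q) : ℤ) : ℂ))⁻¹ • Z) hdec
    simp only [smul_add, smul_smul, inv_mul_cancel₀ hDt, one_smul] at this
    rw [this, div_eq_inv_mul, div_eq_inv_mul]
  apply PiLp.ext
  intro j
  have := congrFun hfun j
  simpa [hX, hU, hV] using this

end ComplexSide

/-! ## The packet amplitudes and their cost -/

section Solve

/-- `∑ⱼ aⱼ (c • b)ⱼ = c (a · b)` for lattice vectors `a, b`. [folklore] -/
theorem sum_cast_mul_smul_freqVec (a b : Fin 3 → ℤ) (c : ℂ) :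
    ∑ j, (a j : ℂ) * (c • Torus.freqVec b) j = c * ((a ⬝ᵥ b : ℤ) : ℂ) := by
  simp only [PiLp.smul_apply, Torus.freqVec_apply, smul_eq_mul, dotProduct, Int.cast_sum, Int.cast_mul,
    Finset.mul_sum]
  exact Finset.sum_congr rfl fun j _ => by ring

/-- `∑ⱼ conj((c • b)ⱼ) aⱼ = conj(c) (b · a)` for lattice vectors `a, b`. [folklore] -/
theorem sum_conj_smul_freqVec_mul (a b : Fin 3 → ℤ) (c : ℂ) :
    ∑ j, conj ((c • Torus.freqVec b) j) * (a j : ℂ) = conj c * ((b ⬝ᵥ a : ℤ) : ℂ) := by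
  simp only [PiLp.smul_apply, Torus.freqVec_apply, smul_eq_mul, map_mul, map_intCast, dotProduct, Int.cast_sum,
    Int.cast_mul, Finset.mul_sum]
  exact Finset.sum_congr rfl fun j _ => by ring

/-- `‖c • b‖² = |c|² |b|²` for a lattice vector `b`. [folklore] -/
theorem norm_sq_smul_freqVec (c : ℂ) (b : Fin 3 → ℤ) :
    ‖c • Torus.freqVec b‖ ^ 2 = ‖c‖ ^ 2 * Torus.freqNormSq b := by
  rw [norm_smul, mul_pow, norm_sq_freqVec]

/-- **One packet**: for `k` with `|k|² ≤ 2`, `k × q ≠ 0`, a scale `L > 0` and a coefficient `α`,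
the amplitudes `x = L u` (`u = |k|²q - (q·k)k`) and `y = (α / (4πi L |k×q|²)) (k × q)` are
transversal (`x ⊥ k`, `y ⊥ k, q`), linearly polarised, produce the stress
`(4πi ∑ⱼ x̄ⱼ qⱼ) • y = α • (k × q)`, and cost `‖x‖² ≤ 4|q|²L²`, `‖y‖² ≤ |α|²/(16π²L²)`. [folklore] -/
theorem exists_packetAmplitude_aux {q k : Fin 3 → ℤ} (hk : Torus.freqNormSq k ≤ 2) (hw : k ⨯₃ q ≠ 0)
    {L : ℝ} (hL : 0 < L) (α : ℂ) :
    ∃ x y : EuclideanSpace ℂ (Fin 3),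
      (∑ j, (k j : ℂ) * x j = 0 ∧ ∑ j, (k j : ℂ) * y j = 0 ∧ ∑ j, (q j : ℂ) * y j = 0) ∧
      ((∃ (a : ℂ) (v : EuclideanSpace ℝ (Fin 3)), x = a • EuclideanSpace.complexify v) ∧
        (∃ (a : ℂ) (v : EuclideanSpace ℝ (Fin 3)), y = a • EuclideanSpace.complexify v)) ∧
      (4 * Real.pi * I * ∑ j, conj (x j) * (q j : ℂ)) • y = α • Torus.freqVec (k ⨯₃ q) ∧
      ‖x‖ ^ 2 ≤ 4 * Torus.freqNormSq q * L ^ 2 ∧ ‖y‖ ^ 2 ≤ ‖α‖ ^ 2 / (16 * Real.pi ^ 2 * L ^ 2) := by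
  set w : Fin 3 → ℤ := k ⨯₃ q with hw_def
  set u : Fin 3 → ℤ := (k ⬝ᵥ k) • q - (q ⬝ᵥ k) • k with hu_def
  set D : ℤ := w ⬝ᵥ w with hD_def
  -- positivity of `D = |k × q|²`
  have hDR : ((D : ℤ) : ℝ) = Torus.freqNormSq w := cast_dotProduct_self_eq_freqNormSq w
  have hD1 : (1 : ℝ) ≤ (D : ℝ) := by rw [hDR]; exact Torus.one_le_freqNormSq hw
  have hD0 : (D : ℝ) ≠ 0 := by linarith
  have hDC : ((D : ℤ) : ℂ) ≠ 0 := by exact_mod_cast (show (D : ℤ) ≠ 0 by exact_mod_cast hD0)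
  have hLC : ((L : ℝ) : ℂ) ≠ 0 := by exact_mod_cast hL.ne'
  have hπC : ((Real.pi : ℝ) : ℂ) ≠ 0 := by exact_mod_cast Real.pi_ne_zero
  -- the amplitudes
  set E : ℂ := (((4 * Real.pi * L * (D : ℝ) : ℝ)) : ℂ) * I with hE_def
  have hE0 : E ≠ 0 := by
    rw [hE_def]; push_cast
    exact mul_ne_zero (mul_ne_zero (mul_ne_zero (mul_ne_zero (by norm_num) hπC) hLC) hDC) Complex.I_ne_zero
  have hEn : ‖E‖ ^ 2 = 16 * Real.pi ^ 2 * L ^ 2 * (D : ℝ) ^ 2 := by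
    rw [hE_def, norm_mul, Complex.norm_I, mul_one, Complex.norm_real, Real.norm_eq_abs, sq_abs]; ring
  set x : EuclideanSpace ℂ (Fin 3) := ((L : ℝ) : ℂ) • Torus.freqVec u with hx_def
  set y : EuclideanSpace ℂ (Fin 3) := (α / E) • Torus.freqVec w with hy_def
  -- integer orthogonality relations
  have hku : k ⬝ᵥ u = 0 := by rw [dotProduct_comm, hu_def, proj_dotProduct_self]
  have hkw : k ⬝ᵥ w = 0 := by rw [hw_def]; exact dot_self_cross k q
  have hqw : q ⬝ᵥ w = 0 := by rw [hw_def]; exact dot_cross_self k q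
  have huq : u ⬝ᵥ q = D := by rw [hu_def, hD_def, hw_def, proj_dotProduct_eq]
  refine ⟨x, y, ⟨?_, ?_, ?_⟩, ⟨⟨_, _, by rw [hx_def, freqVec_eq_complexify]⟩,
    ⟨_, _, by rw [hy_def, freqVec_eq_complexify]⟩⟩, ?_, ?_, ?_⟩
  · rw [hx_def, sum_cast_mul_smul_freqVec, hku, Int.cast_zero, mul_zero]
  · rw [hy_def, sum_cast_mul_smul_freqVec, hkw, Int.cast_zero, mul_zero]
  · rw [hy_def, sum_cast_mul_smul_freqVec, hqw, Int.cast_zero, mul_zero]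
  · -- the stress
    rw [hx_def, sum_conj_smul_freqVec_mul, huq, Complex.conj_ofReal, hy_def, smul_smul]
    congr 1
    rw [hE_def]
    push_cast
    field_simp
  · -- cost of `x`: `‖x‖² = L² |k|² D ≤ L² · 2 · (|k|²|q|²) ≤ 4|q|²L²`
    have hxn : ‖x‖ ^ 2 = L ^ 2 * (Torus.freqNormSq k * (D : ℝ)) := by
      rw [hx_def, norm_sq_smul_freqVec, Complex.norm_real, Real.norm_eq_abs, sq_abs, ← cast_dotProduct_self_eq_freqNormSq u,
        hu_def, proj_dotProduct_proj, ← hw_def, ← hD_def, Int.cast_mul, cast_dotProduct_self_eq_freqNormSq]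
    have hDle : (D : ℝ) ≤ Torus.freqNormSq k * Torus.freqNormSq q := by
      have h1 : (D : ℤ) = (k ⬝ᵥ k) * (q ⬝ᵥ q) - (k ⬝ᵥ q) * (k ⬝ᵥ q) := by
        rw [hD_def, hw_def, cross_dot_cross, dotProduct_comm q k]
      have h2 : ((D : ℤ) : ℝ) = Torus.freqNormSq k * Torus.freqNormSq q - ((k ⬝ᵥ q : ℤ) : ℝ) ^ 2 := by
        rw [h1]; push_cast; rw [cast_dotProduct_self_eq_freqNormSq, cast_dotProduct_self_eq_freqNormSq]; ring
      rw [h2]; nlinarith [sq_nonneg ((k ⬝ᵥ q : ℤ) : ℝ)]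
    rw [hxn]
    have hq0 : 0 ≤ Torus.freqNormSq q := Torus.freqNormSq_nonneg q
    nlinarith [mul_le_mul hk hDle (by linarith) (by norm_num : (0:ℝ) ≤ 2), sq_nonneg L,
      mul_nonneg (sq_nonneg L) hq0]
  · -- cost of `y`: `‖y‖² = |α|² D / ‖E‖² = |α|²/(16π²L²D) ≤ |α|²/(16π²L²)`
    have hyn : ‖y‖ ^ 2 = ‖α‖ ^ 2 / (16 * Real.pi ^ 2 * L ^ 2 * (D : ℝ)) := by
      rw [hy_def, norm_sq_smul_freqVec, norm_div, div_pow, hEn, ← hDR]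
      field_simp
    rw [hyn]
    have hpos : 0 < 16 * Real.pi ^ 2 * L ^ 2 := by positivity
    exact div_le_div_of_nonneg_left (sq_nonneg _) hpos (by nlinarith)

/-- **PACKET AMPLITUDES REALISING A TRANSVERSAL STRESS.** For `q ≠ 0`, wavevectors `k₁, k₂` with
`|kᵢ|² ≤ 2` and `k₁ · (q × k₂) ≠ 0`, and a target `τ ⊥ q`, there are amplitudes `x₁ ⊥ k₁`,
`y₁ ⊥ k₁, q`, `x₂ ⊥ k₂`, `y₂ ⊥ k₂, q`, all linearly polarised (complex multiples of real vectors),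
with `(4πi ∑ⱼ x̄₁ⱼ qⱼ) • y₁ + (4πi ∑ⱼ x̄₂ⱼ qⱼ) • y₂ = τ` and
`‖xᵢ‖² ≤ 4 (1+|q|²)⁻³`, `‖yᵢ‖² ≤ ‖τ‖² (1+|q|²)⁴ / 16`. [folklore] -/
theorem exists_packetAmplitudes {q k₁ k₂ : Fin 3 → ℤ} (hq : q ≠ 0)
    (hk₁ : Torus.freqNormSq k₁ ≤ 2) (hk₂ : Torus.freqNormSq k₂ ≤ 2) (hdet : k₁ ⬝ᵥ (q ⨯₃ k₂) ≠ 0)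
    (τ : EuclideanSpace ℂ (Fin 3)) (hτ : ∑ j, (q j : ℂ) * τ j = 0) :
    ∃ x₁ y₁ x₂ y₂ : EuclideanSpace ℂ (Fin 3),
      (∑ j, (k₁ j : ℂ) * x₁ j = 0 ∧ ∑ j, (k₁ j : ℂ) * y₁ j = 0 ∧ ∑ j, (q j : ℂ) * y₁ j = 0) ∧
      (∑ j, (k₂ j : ℂ) * x₂ j = 0 ∧ ∑ j, (k₂ j : ℂ) * y₂ j = 0 ∧ ∑ j, (q j : ℂ) * y₂ j = 0) ∧
      ((∃ (a : ℂ) (v : EuclideanSpace ℝ (Fin 3)), x₁ = a • EuclideanSpace.complexify v) ∧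
        (∃ (a : ℂ) (v : EuclideanSpace ℝ (Fin 3)), y₁ = a • EuclideanSpace.complexify v) ∧
        (∃ (a : ℂ) (v : EuclideanSpace ℝ (Fin 3)), x₂ = a • EuclideanSpace.complexify v) ∧
        (∃ (a : ℂ) (v : EuclideanSpace ℝ (Fin 3)), y₂ = a • EuclideanSpace.complexify v)) ∧
      (4 * Real.pi * I * ∑ j, conj (x₁ j) * (q j : ℂ)) • y₁ +
          (4 * Real.pi * I * ∑ j, conj (x₂ j) * (q j : ℂ)) • y₂ = τ ∧
      (‖x₁‖ ^ 2 ≤ 4 / (1 + Torus.freqNormSq q) ^ 3 ∧ ‖x₂‖ ^ 2 ≤ 4 / (1 + Torus.freqNormSq q) ^ 3 ∧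
        ‖y₁‖ ^ 2 ≤ ‖τ‖ ^ 2 * (1 + Torus.freqNormSq q) ^ 4 / 16 ∧
        ‖y₂‖ ^ 2 ≤ ‖τ‖ ^ 2 * (1 + Torus.freqNormSq q) ^ 4 / 16) := by
  have hπ : (16 : ℝ) ≤ 8 * Real.pi ^ 2 := by
    have h4 : (2 : ℝ) ^ 2 ≤ Real.pi ^ 2 := pow_le_pow_left₀ (by norm_num) Real.two_le_pi 2
    linarith
  set Q : ℝ := Torus.freqNormSq q with hQ_def
  set P : ℝ := 1 + Q with hP_def
  set L : ℝ := (P ^ 2)⁻¹ with hL_def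
  have hQ1 : 1 ≤ Q := by rw [hQ_def]; exact Torus.one_le_freqNormSq hq
  have hqqR : ((q ⬝ᵥ q : ℤ) : ℝ) = Q := by rw [hQ_def]; exact cast_dotProduct_self_eq_freqNormSq q
  have hP : 0 < P := by rw [hP_def]; linarith
  have hL : 0 < L := by rw [hL_def]; positivity
  have hPL : P ^ 4 * L ^ 2 = 1 := by
    rw [hL_def, inv_pow, ← pow_mul, mul_inv_cancel₀ (pow_ne_zero _ hP.ne')]
  clear_value L P Q
  have hDt : (k₁ ⨯₃ q) ⬝ᵥ ((k₂ ⨯₃ q) ⨯₃ q) = -(k₁ ⬝ᵥ (q ⨯₃ k₂)) * (q ⬝ᵥ q) :=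
    cross_dotProduct_cross_cross q k₁ k₂
  have hDtR : (((k₁ ⨯₃ q) ⬝ᵥ ((k₂ ⨯₃ q) ⨯₃ q) : ℤ) : ℝ) ^ 2 = ((k₁ ⬝ᵥ (q ⨯₃ k₂) : ℤ) : ℝ) ^ 2 * Q ^ 2 := by
    rw [hDt]; push_cast; rw [hqqR]; ring
  have hdet1 : (1 : ℝ) ≤ ((k₁ ⬝ᵥ (q ⨯₃ k₂) : ℤ) : ℝ) ^ 2 := one_le_sq_cast_of_ne_zero hdet
  have hDtQ : Q ^ 2 ≤ (((k₁ ⨯₃ q) ⬝ᵥ ((k₂ ⨯₃ q) ⨯₃ q) : ℤ) : ℝ) ^ 2 := by rw [hDtR]; nlinarith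
  have hDt0 : (((k₁ ⨯₃ q) ⬝ᵥ ((k₂ ⨯₃ q) ⨯₃ q) : ℤ) : ℝ) ≠ 0 := by
    intro h; rw [h] at hDtQ; nlinarith
  have hDt2 : (0 : ℝ) < (((k₁ ⨯₃ q) ⬝ᵥ ((k₂ ⨯₃ q) ⨯₃ q) : ℤ) : ℝ) ^ 2 := by nlinarith
  -- the stress directions are non-zero
  have hw₁0 : k₁ ⨯₃ q ≠ 0 := by
    intro h
    apply hDt0
    rw [h, zero_dotProduct, Int.cast_zero]
  have hw₂0 : k₂ ⨯₃ q ≠ 0 := by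
    intro h
    apply hDt0
    rw [h, LinearMap.map_zero₂, dotProduct_zero, Int.cast_zero]
  -- `|k × q|² ≤ 2 Q`
  have hww : ∀ k : Fin 3 → ℤ, Torus.freqNormSq k ≤ 2 → (((k ⨯₃ q) ⬝ᵥ (k ⨯₃ q) : ℤ) : ℝ) ≤ 2 * Q := by
    intro k hk
    have e1 : ((k ⨯₃ q) ⬝ᵥ (k ⨯₃ q) : ℤ) = (k ⬝ᵥ k) * (q ⬝ᵥ q) - (k ⬝ᵥ q) * (k ⬝ᵥ q) := by
      rw [cross_dot_cross, dotProduct_comm q k]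
    have e2 : (((k ⨯₃ q) ⬝ᵥ (k ⨯₃ q) : ℤ) : ℝ) = Torus.freqNormSq k * Q - ((k ⬝ᵥ q : ℤ) : ℝ) ^ 2 := by
      rw [e1]; push_cast; rw [cast_dotProduct_self_eq_freqNormSq, hqqR]; ring
    rw [e2]; nlinarith [sq_nonneg ((k ⬝ᵥ q : ℤ) : ℝ)]
  have hα : ∀ B : ℂ, ‖B‖ ^ 2 ≤ 2 * Q ^ 2 * ‖τ‖ ^ 2 →
      ‖B / (((k₁ ⨯₃ q) ⬝ᵥ ((k₂ ⨯₃ q) ⨯₃ q) : ℤ) : ℂ)‖ ^ 2 ≤ 2 * ‖τ‖ ^ 2 := by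
    intro B hB
    rw [norm_div, div_pow, Complex.norm_intCast, sq_abs, div_le_iff₀ hDt2]
    have h4 : 0 ≤ 2 * ‖τ‖ ^ 2 := by positivity
    nlinarith [mul_le_mul_of_nonneg_left hDtQ h4]
  have hybound : ∀ (y : EuclideanSpace ℂ (Fin 3)) (B : ℂ), ‖B‖ ^ 2 ≤ 2 * Q ^ 2 * ‖τ‖ ^ 2 →
      ‖y‖ ^ 2 ≤ ‖B / (((k₁ ⨯₃ q) ⬝ᵥ ((k₂ ⨯₃ q) ⨯₃ q) : ℤ) : ℂ)‖ ^ 2 / (16 * Real.pi ^ 2 * L ^ 2) →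
      ‖y‖ ^ 2 ≤ ‖τ‖ ^ 2 * P ^ 4 / 16 := by
    intro y B hB hy
    have h1 := hα B hB
    calc ‖y‖ ^ 2 ≤ ‖B / (((k₁ ⨯₃ q) ⬝ᵥ ((k₂ ⨯₃ q) ⨯₃ q) : ℤ) : ℂ)‖ ^ 2 / (16 * Real.pi ^ 2 * L ^ 2) := hy
      _ ≤ 2 * ‖τ‖ ^ 2 / (16 * Real.pi ^ 2 * L ^ 2) := by gcongr
      _ = ‖τ‖ ^ 2 * P ^ 4 / (8 * Real.pi ^ 2) := by
          rw [div_eq_div_iff (by positivity) (by positivity)]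
          linear_combination (-(16 * Real.pi ^ 2 * ‖τ‖ ^ 2)) * hPL
      _ ≤ ‖τ‖ ^ 2 * P ^ 4 / 16 := div_le_div_of_nonneg_left (by positivity) (by norm_num) hπ
  have hxbound : ∀ (x : EuclideanSpace ℂ (Fin 3)), ‖x‖ ^ 2 ≤ 4 * Torus.freqNormSq q * L ^ 2 →
      ‖x‖ ^ 2 ≤ 4 / P ^ 3 := by
    intro x hx
    have hQP : Q ≤ P := by rw [hP_def]; linarith
    have hP3 : 0 < P ^ 3 := pow_pos hP 3
    calc ‖x‖ ^ 2 ≤ 4 * Torus.freqNormSq q * L ^ 2 := hx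
      _ = 4 * Q / P ^ 4 := by rw [← hQ_def, hL_def]; ring
      _ ≤ 4 / P ^ 3 := (div_le_div_iff₀ (pow_pos hP 4) hP3).2 (by nlinarith)
  -- bounds on the coefficients: `|Bᵢ|² ≤ 2 Q² ‖τ‖²`
  have hB₁n : ‖∑ j, ((((k₂ ⨯₃ q) ⨯₃ q) j : ℤ) : ℂ) * τ j‖ ^ 2 ≤ 2 * Q ^ 2 * ‖τ‖ ^ 2 := by
    have h1 := norm_sq_sum_mul_le ((k₂ ⨯₃ q) ⨯₃ q) τ
    have h2 : Torus.freqNormSq ((k₂ ⨯₃ q) ⨯₃ q) = (((k₂ ⨯₃ q) ⬝ᵥ (k₂ ⨯₃ q) : ℤ) : ℝ) * Q := by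
      rw [← cast_dotProduct_self_eq_freqNormSq, cross_cross_dotProduct_self, Int.cast_mul, hqqR]
    rw [h2] at h1
    have h3 := hww k₂ hk₂
    have h4 : 0 ≤ Q * ‖τ‖ ^ 2 := by positivity
    nlinarith
  have hB₂n : ‖∑ j, (((q ⨯₃ (k₁ ⨯₃ q)) j : ℤ) : ℂ) * τ j‖ ^ 2 ≤ 2 * Q ^ 2 * ‖τ‖ ^ 2 := by
    have h1 := norm_sq_sum_mul_le (q ⨯₃ (k₁ ⨯₃ q)) τ
    have h2 : Torus.freqNormSq (q ⨯₃ (k₁ ⨯₃ q)) = (((k₁ ⨯₃ q) ⬝ᵥ (k₁ ⨯₃ q) : ℤ) : ℝ) * Q := by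
      rw [← cast_dotProduct_self_eq_freqNormSq, self_cross_cross_dotProduct, Int.cast_mul, hqqR]
    rw [h2] at h1
    have h3 := hww k₁ hk₁
    have h4 : 0 ≤ Q * ‖τ‖ ^ 2 := by positivity
    nlinarith
  obtain ⟨x₁, y₁, ht₁, hp₁, hs₁, hx₁, hy₁⟩ := exists_packetAmplitude_aux (q := q) hk₁ hw₁0 hL
    ((∑ j, ((((k₂ ⨯₃ q) ⨯₃ q) j : ℤ) : ℂ) * τ j) / (((k₁ ⨯₃ q) ⬝ᵥ ((k₂ ⨯₃ q) ⨯₃ q) : ℤ) : ℂ))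
  obtain ⟨x₂, y₂, ht₂, hp₂, hs₂, hx₂, hy₂⟩ := exists_packetAmplitude_aux (q := q) hk₂ hw₂0 hL
    ((∑ j, (((q ⨯₃ (k₁ ⨯₃ q)) j : ℤ) : ℂ) * τ j) / (((k₁ ⨯₃ q) ⬝ᵥ ((k₂ ⨯₃ q) ⨯₃ q) : ℤ) : ℂ))
  refine ⟨x₁, y₁, x₂, y₂, ht₁, ht₂, ⟨hp₁.1, hp₁.2, hp₂.1, hp₂.2⟩, ?_,
    ⟨hxbound x₁ hx₁, hxbound x₂ hx₂, hybound y₁ _ hB₁n hy₁, hybound y₂ _ hB₂n hy₂⟩⟩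
  -- the stress equation
  rw [hs₁, hs₂]
  exact (target_eq_sum_smul hdet hq hτ).symm

end Solve

/-- **Registered sub-goal `balancedMenu_packetAmplitudes` of stub S5 `stub_balancedMenu`** (summary
of this file): packet amplitudes realising any transversal stress at momentum `q`, with their cost.
[folklore] -/
theorem balancedMenu_packetAmplitudes : ∀ (q k₁ k₂ : Fin 3 → ℤ) (τ : EuclideanSpace ℂ (Fin 3)), q ≠ 0 → Torus.freqNormSq k₁ ≤ 2 → Torus.freqNormSq k₂ ≤ 2 → k₁ ⬝ᵥ crossProduct q k₂ ≠ 0 → ∑ j, (q j : ℂ) * τ j = 0 → ∃ x₁ y₁ x₂ y₂ : EuclideanSpace ℂ (Fin 3), (∑ j, (k₁ j : ℂ) * x₁ j = 0 ∧ ∑ j, (k₁ j : ℂ) * y₁ j = 0 ∧ ∑ j, (q j : ℂ) * y₁ j = 0) ∧ (∑ j, (k₂ j : ℂ) * x₂ j = 0 ∧ ∑ j, (k₂ j : ℂ) * y₂ j = 0 ∧ ∑ j, (q j : ℂ) * y₂ j = 0) ∧ ((∃ (a : ℂ) (v : EuclideanSpace ℝ (Fin 3)), x₁ = a • EuclideanSpace.complexify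 v) ∧ (∃ (a : ℂ) (v : EuclideanSpace ℝ (Fin 3)), y₁ = a • EuclideanSpace.complexify v) ∧ (∃ (a : ℂ) (v : EuclideanSpace ℝ (Fin 3)), x₂ = a • EuclideanSpace.complexify v) ∧ (∃ (a : ℂ) (v : EuclideanSpace ℝ (Fin 3)), y₂ = a • EuclideanSpace.complexify v)) ∧ (4 * Real.pi * Complex.I * ∑ j, (starRingEnd ℂ) (x₁ j) * (q j : ℂ)) • y₁ + (4 * Real.pi * Complex.I * ∑ j, (starRingEnd ℂ) (x₂ j) * (q j : ℂ)) • y₂ = τ ∧ (‖x₁‖ ^ 2 ≤ 4 / (1 + Torus.freqNormSq q) ^ 3 ∧ ‖x₂‖ ^ 2 ≤ 4 / (1 + Torus.freqNormSq q) ^ 3 ∧ ‖y₁‖ ^ 2 ≤ ‖τ‖ ^ 2 * (1 + Torus.freqNormSq q) ^ 4 / 16 ∧ ‖y₂‖ ^ 2 ≤ ‖τ‖ ^ 2 * (1 + Torus.freqNormSq q) ^ 4 / 16) :=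
  fun _ _ _ τ hq hk₁ hk₂ hdet hτ => exists_packetAmplitudes hq hk₁ hk₂ hdet τ hτ

end Summit.AnomalousDissipation.AnomalousDissipation.Theorems.MomentParityCubicParityLoud
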